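import Literature.NumberTheory.Sieve.QuadraticRootsLevelUnfold
import Literature.NumberTheory.Automorphic.InvariantLaplacian
import HarnessLib

/-!
# The Poincaré series of a strip kernel on `Γ₀(q)` (DFI 1995, Prop. 4, support file)

Topic `Literature/NumberTheory/Sieve`.  Third support file (after
`QuadraticRootsPrimeModuliDFIGamma0Domain.lean` and `QuadraticRootsPrimeModuliDFIStrip.lean`) of
the elementary proof of Proposition 4 of W. Duke, J. B. Friedlander, H. Iwaniec,
*Equidistribution of roots of a quadratic congruence to prime moduli*, Ann. of Math. 141 (1995)
(the named fact `Literature.NumberTheory.Sieve.dukeFriedlanderIwaniec1995_proposition4`).  The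
paper (§3) bounds the values `P(τz)` of the Poincaré series (14),
`P(z) = ∑_{σ ∈ Γ∞∖Γ₀(q)} F(2πh Im σz) e(h Re σz)`, through the spectral theorem on `Γ₀(q)∖ℍ`,
the pre-trace formula, Kuznetsov's formula and Weil's bound (Proposition 3).  Our route keeps only
Weil's bound: `|P(w)|²` is bounded by a local Sobolev inequality through
`∫ (|P|² + |ΔP|²)` over a neighbourhood of `w`, that integral by the same integral over a
fundamental domain (finite multiplicity, unfolding), and the global norms are computed by
unfolding the Poincaré series (Kloosterman sums, Weil's bound).  This file supplies the basic
analysis of the series for a **strip kernel** `ψ(z) = Φ(Im z) e(η Re z)` (`η ∈ ℤ`):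

* the strip kernel (written as an explicit lambda, this file has no definitions) and its
  invariance under `z ↦ z + 1`, size, support and regularity;
* local finiteness: near every point the series `RootForms.poincareFn q ψ` is a finite sum
  (`exists_finset_poincareFn_eq_sum_nhds`), hence it is `C²` when `Φ` is
  (`isC2_poincareFn`) and **`Δ` passes through the series**:
  `Δ P_ψ = P_{Δψ}` (`hypLaplacian_poincareFn`);
* `Γ₀(q)`-invariance of `P_ψ` (`poincareFn_smul_of_mem_Gamma0`);
* the **uniform bound** `|P_ψ(z)| ≤ M sup |Φ|` (`exists_norm_poincareFn_le`), `M`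
  the covering multiplicity of the box `[0,1] × [Y₁, Y₂]` under `SL₂(ℤ)`
  (`QuadraticRootsPrimeModuliDFIGamma0Domain.exists_multiplicity_bound`).

Everything here is proved; no statement of the paper is vendored (no new named fact).

## References

* W. Duke, J. B. Friedlander, H. Iwaniec, Ann. of Math. (2) 141 (1995), 423–441, (14) p. 428 and
  §3. [cite: DukeFriedlanderIwaniec1995, §3]
* H. Iwaniec, *Spectral Methods of Automorphic Forms*, 2nd ed., GSM 53 (2002), §2.3 (the cosets
  `Γ∞∖Γ₀(q)`), §3.2 (Poincaré series). [cite: Iwaniec2002, §3.2]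
-/

noncomputable section

namespace Literature.NumberTheory.Sieve

open scoped MatrixGroups UpperHalfPlane Real _root_.Topology _root_.ENNReal
open _root_.UpperHalfPlane _root_.MeasureTheory _root_.Set _root_.Filter
open _root_.ModularGroup (T)
open _root_.Literature.NumberTheory.Automorphic

namespace DFI1995

variable {q : ℕ}

/-! ### Strip kernels

The summand of DFI's Poincaré series (14) is the **strip kernel** `ψ_{Φ,η}(z) = Φ(Im z) e(η Re z)`
(`e(t) = exp(2πit)`, `Φ(y) = F(2πhy)`, `η = h ∈ ℤ`).  To keep this file free of definitions it is
written out as the lambda `fun z : ℍ => Φ z.im * Complex.exp (2 * π * Complex.I * η * z.re)`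
wherever it occurs. -/

/-- The oscillating factor has modulus one. [folklore] -/
theorem norm_exp_two_pi_mul_I_mul (η : ℤ) (x : ℝ) :
    ‖Complex.exp (2 * π * Complex.I * η * (x : ℂ))‖ = 1 := by
  have : (2 * π * Complex.I * η * (x : ℂ)) = ((2 * π * η * x : ℝ) : ℂ) * Complex.I := by
    push_cast; ring
  rw [this, Complex.norm_exp_ofReal_mul_I]

/-- `|ψ_{Φ,η}(z)| = |Φ(Im z)|`. [folklore] -/
theorem norm_stripKernel (Φ : ℝ → ℂ) (η : ℤ) (z : ℍ) :
    ‖Φ z.im * Complex.exp (2 * π * Complex.I * η * (z.re : ℂ))‖ = ‖Φ z.im‖ := by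
  rw [norm_mul, norm_exp_two_pi_mul_I_mul, mul_one]

/-- `ψ_{Φ,η}(z) ≠ 0` forces `Φ(Im z) ≠ 0`. [folklore] -/
theorem apply_im_ne_zero_of_stripKernel_ne_zero {Φ : ℝ → ℂ} {η : ℤ} {z : ℍ}
    (h : Φ z.im * Complex.exp (2 * π * Complex.I * η * (z.re : ℂ)) ≠ 0) : Φ z.im ≠ 0 := by
  intro h0
  exact h (by rw [h0, zero_mul])

/-- **Invariance under `z ↦ z + 1`** (`η ∈ ℤ`): `ψ(T • z) = ψ(z)`. [folklore] -/
theorem stripKernel_T_smul (Φ : ℝ → ℂ) (η : ℤ) (z : ℍ) :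
    Φ (T • z).im * Complex.exp (2 * π * Complex.I * η * ((T • z).re : ℂ)) =
      Φ z.im * Complex.exp (2 * π * Complex.I * η * (z.re : ℂ)) := by
  rw [ModularGroup.im_T_smul, ModularGroup.re_T_smul]
  congr 1
  push_cast
  have : 2 * π * Complex.I * η * ((z.re : ℂ) + 1) =
      2 * π * Complex.I * η * (z.re : ℂ) + η * (2 * π * Complex.I) := by ring
  rw [this, Complex.exp_add, Complex.exp_int_mul_two_pi_mul_I, mul_one]

/-- The `ℂ`-extension of the strip kernel agrees on the open upper half-plane with the globally
defined function `w ↦ Φ(Im w) e(η Re w)`. [folklore] -/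
theorem stripKernel_comp_ofComplex_eqOn (Φ : ℝ → ℂ) (η : ℤ) :
    EqOn ((fun z : ℍ => Φ z.im * Complex.exp (2 * π * Complex.I * η * (z.re : ℂ))) ∘ ofComplex)
      (fun w : ℂ => Φ w.im * Complex.exp (2 * π * Complex.I * η * (w.re : ℂ))) {w : ℂ | 0 < w.im} := by
  intro w hw
  have hw' : 0 < w.im := hw
  simp only [Function.comp_apply]
  rw [ofComplex_apply_of_im_pos hw']
  rfl

/-- The oscillating factor `w ↦ e(η Re w)` is smooth on `ℂ` (as a real manifold). [folklore] -/
theorem contDiff_exp_re (η : ℤ) {n : WithTop ℕ∞} :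
    ContDiff ℝ n (fun w : ℂ => Complex.exp (2 * π * Complex.I * η * (w.re : ℂ))) := by
  have h1 : ContDiff ℝ n (fun w : ℂ => ((w.re : ℝ) : ℂ)) :=
    (Complex.ofRealCLM.contDiff.comp Complex.reCLM.contDiff)
  have h2 : ContDiff ℝ n (fun w : ℂ => 2 * π * Complex.I * η * (w.re : ℂ)) :=
    contDiff_const.mul h1
  have h3 : ContDiff ℝ n (Complex.exp : ℂ → ℂ) := Complex.contDiff_exp
  exact h3.comp h2

/-- **Regularity**: if `Φ` is `Cⁿ` on `(0, ∞)` then the extension `ψ ∘ ofComplex` of the strip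
kernel is `Cⁿ` on the open upper half-plane. [folklore] -/
theorem contDiffOn_stripKernel {Φ : ℝ → ℂ} {n : WithTop ℕ∞} (hΦ : ContDiffOn ℝ n Φ (Ioi 0)) (η : ℤ) :
    ContDiffOn ℝ n
      ((fun z : ℍ => Φ z.im * Complex.exp (2 * π * Complex.I * η * (z.re : ℂ))) ∘ ofComplex)
      {w : ℂ | 0 < w.im} := by
  refine ContDiffOn.congr ?_ (stripKernel_comp_ofComplex_eqOn Φ η)
  have h1 : ContDiffOn ℝ n (fun w : ℂ => Φ w.im) {w : ℂ | 0 < w.im} := by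
    have := hΦ.comp Complex.imCLM.contDiff.contDiffOn (fun w (hw : w ∈ {w : ℂ | 0 < w.im}) => hw)
    exact this
  exact h1.mul (contDiff_exp_re η).contDiffOn

/-- In particular the strip kernel of a `C²` profile is `C²` on `ℍ` (`IsC2`). [folklore] -/
theorem isC2_stripKernel {Φ : ℝ → ℂ} (hΦ : ContDiffOn ℝ 2 Φ (Ioi 0)) (η : ℤ) :
    IsC2 (fun z : ℍ => Φ z.im * Complex.exp (2 * π * Complex.I * η * (z.re : ℂ))) :=
  contDiffOn_stripKernel hΦ η

/-! ### Local finiteness of the Poincaré series -/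

/-- The cosets `σ ∈ Γ∞∖Γ₀(q)` lifting some point of a neighbourhood of `z₀` to height `≥ Y₁ > 0`
form a finite set: there is a finite `S` and a neighbourhood `U` of `z₀` with
`Im(σ_p • z) ≥ Y₁ ⇒ p ∈ S` for all `z ∈ U`. [cite: Iwaniec2002, §2.3] -/
theorem exists_finset_nhds_of_height (q : ℕ) {Y₁ : ℝ} (hY₁ : 0 < Y₁) (z₀ : ℍ) :
    ∃ S : Finset (CuspPair q), ∃ U ∈ 𝓝 z₀, ∀ z ∈ U, ∀ p : CuspPair q,
      Y₁ ≤ (p.toSL • z).im → p ∈ S := by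
  have hy0 : 0 < z₀.im / 2 := by have := z₀.im_pos; linarith
  obtain hfin := RootForms.finite_cuspPairs_above q (X₀ := |z₀.re| + 1) (y₀ := z₀.im / 2)
    (y₁ := 2 * z₀.im) (Y := Y₁) hy0 hY₁
  refine ⟨hfin.toFinset, {z : ℍ | |z.re - z₀.re| < 1 ∧ z₀.im / 2 < z.im ∧ z.im < 2 * z₀.im}, ?_, ?_⟩
  · have hopen : IsOpen {z : ℍ | |z.re - z₀.re| < 1 ∧ z₀.im / 2 < z.im ∧ z.im < 2 * z₀.im} := by
      refine (isOpen_lt (continuous_abs.comp (UpperHalfPlane.continuous_re.sub continuous_const))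
        continuous_const).inter
        ((isOpen_lt continuous_const UpperHalfPlane.continuous_im).inter
          (isOpen_lt UpperHalfPlane.continuous_im continuous_const))
    refine hopen.mem_nhds ?_
    have h0 := z₀.im_pos
    refine ⟨by simp, by linarith, by linarith⟩
  · rintro z ⟨hre, him1, him2⟩ p hp
    rw [Set.Finite.mem_toFinset]
    refine ⟨z, ?_, him1.le, him2.le, hp⟩
    have : |z.re| ≤ |z.re - z₀.re| + |z₀.re| := by
      have := abs_add_le (z.re - z₀.re) z₀.re
      rwa [sub_add_cancel] at this
    linarith

/-- A kernel vanishing below the height `Y₁` and a finite set `S` containing all cosets reaching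
that height at `z`: the Poincaré series at `z` is the finite sum over `S`. [folklore] -/
theorem poincareFn_eq_sum_of_height {φ : ℍ → ℂ} {Y₁ : ℝ} (hφ : ∀ z : ℍ, φ z ≠ 0 → Y₁ ≤ z.im)
    {S : Finset (CuspPair q)} {z : ℍ} (hS : ∀ p : CuspPair q, Y₁ ≤ (p.toSL • z).im → p ∈ S) :
    RootForms.poincareFn q φ z = ∑ p ∈ S, φ (p.toSL • z) := by
  unfold RootForms.poincareFn
  refine tsum_eq_sum fun p hp => ?_
  by_contra h
  exact hp (hS p (hφ _ h))

/-- **Local finiteness**: for a kernel vanishing below a positive height, near every point the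
Poincaré series is a fixed finite sum of translates. [cite: Iwaniec2002, §3.2] -/
theorem exists_finset_poincareFn_eq_sum_nhds (q : ℕ) {φ : ℍ → ℂ} {Y₁ : ℝ} (hY₁ : 0 < Y₁)
    (hφ : ∀ z : ℍ, φ z ≠ 0 → Y₁ ≤ z.im) (z₀ : ℍ) :
    ∃ S : Finset (CuspPair q), ∀ᶠ z in 𝓝 z₀,
      (∀ p : CuspPair q, Y₁ ≤ (p.toSL • z).im → p ∈ S) ∧
      RootForms.poincareFn q φ z = ∑ p ∈ S, φ (p.toSL • z) := by
  obtain ⟨S, U, hU, hS⟩ := exists_finset_nhds_of_height q hY₁ z₀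
  refine ⟨S, ?_⟩
  filter_upwards [hU] with z hz
  exact ⟨hS z hz, poincareFn_eq_sum_of_height hφ (hS z hz)⟩


/-! ### Smoothness of the Poincaré series and `Δ P_ψ = P_{Δψ}` -/

/-- The matrix `σ_p` as an element of `GL₂(ℝ)⁺` acts on `ℍ` as `p.toSL`. [folklore] -/
theorem mapGL_toSL_smul (p : CuspPair q) (z : ℍ) :
    (Matrix.SpecialLinearGroup.mapGL ℝ p.toSL : GL (Fin 2) ℝ) • z = p.toSL • z := rfl

/-- `det σ > 0` in `GL₂(ℝ)` for `σ ∈ SL₂(ℤ)`. [folklore] -/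
theorem det_mapGL_pos (g : SL(2, ℤ)) :
    0 < ((Matrix.SpecialLinearGroup.mapGL ℝ g : GL (Fin 2) ℝ)).det.val :=
  det_pos_of_mem_range_toGL ⟨_, rfl⟩

/-- Each translate `z ↦ φ(σ_p • z)` of a `C²` kernel is `C²`. [folklore] -/
theorem isC2_comp_toSL_smul {φ : ℍ → ℂ} (hφ : IsC2 φ) (p : CuspPair q) :
    IsC2 (fun z : ℍ => φ (p.toSL • z)) := by
  have := IsC2.comp_smul (det_mapGL_pos p.toSL) hφ
  simpa only [mapGL_toSL_smul] using this

/-- Transport of neighbourhood statements from `ℍ` to `ℂ` along `ofComplex`: the inclusion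
`ℍ → ℂ` is an open embedding and `ofComplex ∘ (↑) = id`. [folklore] -/
theorem eventually_nhds_coe_ofComplex {z₀ : ℍ} {P : ℍ → Prop} (h : ∀ᶠ z in 𝓝 z₀, P z) :
    ∀ᶠ w in 𝓝 (z₀ : ℂ), P (ofComplex w) := by
  rw [← UpperHalfPlane.isOpenEmbedding_coe.map_nhds_eq, Filter.eventually_map]
  filter_upwards [h] with z hz
  simpa only [ofComplex_apply] using hz

/-- Near a point of the open upper half-plane, the `ℂ`-extension of the Poincaré series of a kernel
vanishing below a positive height agrees with the extension of a finite sum of translates.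
[folklore] -/
theorem exists_finset_poincareFn_comp_ofComplex_eventuallyEq (q : ℕ) {φ : ℍ → ℂ} {Y₁ : ℝ}
    (hY₁ : 0 < Y₁) (hφ : ∀ z : ℍ, φ z ≠ 0 → Y₁ ≤ z.im) (z₀ : ℍ) :
    ∃ S : Finset (CuspPair q),
      (∀ p : CuspPair q, Y₁ ≤ (p.toSL • z₀).im → p ∈ S) ∧
      (RootForms.poincareFn q φ ∘ ofComplex : ℂ → ℂ) =ᶠ[𝓝 (z₀ : ℂ)]
        ((fun z : ℍ => ∑ p ∈ S, φ (p.toSL • z)) ∘ ofComplex) := by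
  obtain ⟨S, hS⟩ := exists_finset_poincareFn_eq_sum_nhds q hY₁ hφ z₀
  refine ⟨S, (hS.self_of_nhds).1, ?_⟩
  filter_upwards [eventually_nhds_coe_ofComplex hS] with w hw
  simp only [Function.comp_apply]
  exact hw.2

/-- **The Poincaré series of a `C²` kernel vanishing below a positive height is `C²`.**
[cite: Iwaniec2002, §3.2] -/
theorem isC2_poincareFn (q : ℕ) {φ : ℍ → ℂ} {Y₁ : ℝ} (hY₁ : 0 < Y₁)
    (hφ : ∀ z : ℍ, φ z ≠ 0 → Y₁ ≤ z.im) (hφ2 : IsC2 φ) :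
    IsC2 (RootForms.poincareFn q φ) := by
  intro w₀ hw₀
  have hw₀' : 0 < w₀.im := hw₀
  obtain ⟨S, -, hS⟩ := exists_finset_poincareFn_comp_ofComplex_eventuallyEq q hY₁ hφ ⟨w₀, hw₀'⟩
  have hsum : ContDiffOn ℝ 2 ((fun z : ℍ => ∑ p ∈ S, φ (p.toSL • z)) ∘ ofComplex : ℂ → ℂ)
      {w : ℂ | 0 < w.im} := by
    have : ((fun z : ℍ => ∑ p ∈ S, φ (p.toSL • z)) ∘ ofComplex : ℂ → ℂ) =
        fun w => ∑ p ∈ S, ((fun z : ℍ => φ (p.toSL • z)) ∘ ofComplex) w := by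
      funext w; simp
    rw [this]
    exact ContDiffOn.sum fun p _ => isC2_comp_toSL_smul hφ2 p
  have hat : ContDiffAt ℝ 2 ((fun z : ℍ => ∑ p ∈ S, φ (p.toSL • z)) ∘ ofComplex : ℂ → ℂ) w₀ :=
    (hsum w₀ hw₀).contDiffAt (isOpen_upperHalfPlaneSet.mem_nhds hw₀')
  exact (hat.congr_of_eventuallyEq hS).contDiffWithinAt

/-- `Δ` of a finite sum of `C²` functions on `ℍ` is the sum of the Laplacians (Mathlib's
`ContDiffAt.laplacian_add`, by induction). [folklore] -/
theorem hypLaplacian_fsum {ι : Type*} (s : Finset ι) (f : ι → ℍ → ℂ)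
    (hf : ∀ i ∈ s, IsC2 (f i)) (z : ℍ) :
    hypLaplacian (fun w => ∑ i ∈ s, f i w) z = ∑ i ∈ s, hypLaplacian (f i) z := by
  classical
  induction s using Finset.induction_on with
  | empty =>
    simp only [Finset.sum_empty]
    have : ((fun _ : ℍ => (0 : ℂ)) ∘ ofComplex : ℂ → ℂ) = fun _ => 0 := rfl
    simp [hypLaplacian, this, InnerProductSpace.laplacian_const]
  | insert a s ha ih =>
    have hfa : IsC2 (f a) := hf a (Finset.mem_insert_self a s)
    have hf' : ∀ i ∈ s, IsC2 (f i) := fun i hi => hf i (Finset.mem_insert_of_mem hi)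
    rw [Finset.sum_insert ha, ← ih hf']
    have e : ((fun w => ∑ i ∈ insert a s, f i w) ∘ ofComplex : ℂ → ℂ) =
        (f a ∘ ofComplex) + ((fun w => ∑ i ∈ s, f i w) ∘ ofComplex) := by
      funext w; simp [Finset.sum_insert ha]
    have hsumC2 : IsC2 (fun w => ∑ i ∈ s, f i w) := by
      have e2 : ((fun w : ℍ => ∑ i ∈ s, f i w) ∘ ofComplex : ℂ → ℂ) =
          fun w => ∑ i ∈ s, (f i ∘ ofComplex) w := by
        funext w; simp
      show ContDiffOn ℝ 2 _ _
      rw [e2]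
      exact ContDiffOn.sum fun i hi => hf' i hi
    have h1 : ContDiffAt ℝ 2 (f a ∘ ofComplex : ℂ → ℂ) (z : ℂ) :=
      (hfa _ z.im_pos).contDiffAt (isOpen_upperHalfPlaneSet.mem_nhds z.im_pos)
    have h2 : ContDiffAt ℝ 2 ((fun w => ∑ i ∈ s, f i w) ∘ ofComplex : ℂ → ℂ) (z : ℂ) :=
      (hsumC2 _ z.im_pos).contDiffAt (isOpen_upperHalfPlaneSet.mem_nhds z.im_pos)
    unfold hypLaplacian
    rw [e, h1.laplacian_add h2]
    ring

/-- A kernel vanishing on the open region `Im z < Y₁` has vanishing Laplacian there. [folklore] -/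
theorem hypLaplacian_eq_zero_of_height {φ : ℍ → ℂ} {Y₁ : ℝ}
    (hφ : ∀ z : ℍ, φ z ≠ 0 → Y₁ ≤ z.im) {z : ℍ} (hz : z.im < Y₁) :
    hypLaplacian φ z = 0 := by
  unfold hypLaplacian
  have heq : (φ ∘ ofComplex : ℂ → ℂ) =ᶠ[𝓝 (z : ℂ)] fun _ => (0 : ℂ) := by
    have hopen : IsOpen {w : ℂ | 0 < w.im ∧ w.im < Y₁} :=
      (isOpen_lt continuous_const Complex.continuous_im).inter
        (isOpen_lt Complex.continuous_im continuous_const)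
    filter_upwards [hopen.mem_nhds ⟨z.im_pos, hz⟩] with w hw
    simp only [Function.comp_apply]
    by_contra h
    have h' := hφ _ h
    rw [ofComplex_apply_of_im_pos hw.1] at h'
    exact absurd hw.2 (not_lt.mpr h')
  rw [(InnerProductSpace.laplacian_congr_nhds heq).self_of_nhds]
  simp [InnerProductSpace.laplacian_const]

/-- The Laplacian of a kernel vanishing below the height `Y₁` vanishes below `Y₁`. [folklore] -/
theorem height_of_hypLaplacian_ne_zero {φ : ℍ → ℂ} {Y₁ : ℝ}
    (hφ : ∀ z : ℍ, φ z ≠ 0 → Y₁ ≤ z.im) (z : ℍ) (hz : hypLaplacian φ z ≠ 0) : Y₁ ≤ z.im := by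
  by_contra h
  exact hz (hypLaplacian_eq_zero_of_height hφ (not_le.mp h))

/-- **`Δ` passes through the Poincaré series**: for a `C²` kernel `φ` vanishing below a positive
height, `Δ P_φ = P_{Δφ}` pointwise (near each point the series is a finite sum and `Δ` commutes
with the action of `Γ₀(q)`, `hypLaplacian_comp_smul`). [cite: Iwaniec2002, §1.6 and §3.2] -/
theorem hypLaplacian_poincareFn (q : ℕ) {φ : ℍ → ℂ} {Y₁ : ℝ} (hY₁ : 0 < Y₁)
    (hφ : ∀ z : ℍ, φ z ≠ 0 → Y₁ ≤ z.im) (hφ2 : IsC2 φ) (z : ℍ) :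
    hypLaplacian (RootForms.poincareFn q φ) z =
      RootForms.poincareFn q (fun w => hypLaplacian φ w) z := by
  obtain ⟨S, hSz, hS⟩ := exists_finset_poincareFn_comp_ofComplex_eventuallyEq q hY₁ hφ z
  -- the right-hand side is the finite sum over the same `S`
  rw [poincareFn_eq_sum_of_height (height_of_hypLaplacian_ne_zero hφ) hSz]
  -- the left-hand side: `Δ` of the finite sum
  have h1 : hypLaplacian (RootForms.poincareFn q φ) z =
      hypLaplacian (fun w : ℍ => ∑ p ∈ S, φ (p.toSL • w)) z := by
    unfold hypLaplacian
    rw [(InnerProductSpace.laplacian_congr_nhds hS).self_of_nhds]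
  rw [h1]
  have h2 : hypLaplacian (fun w : ℍ => ∑ p ∈ S, φ (p.toSL • w)) z =
      ∑ p ∈ S, hypLaplacian (fun w : ℍ => φ (p.toSL • w)) z := by
    exact hypLaplacian_fsum S (fun p w => φ (p.toSL • w)) (fun p _ => isC2_comp_toSL_smul hφ2 p) z
  rw [h2]
  refine Finset.sum_congr rfl fun p _ => ?_
  have := hypLaplacian_comp_smul (det_mapGL_pos p.toSL) φ z
    ((hφ2 _ (p.toSL • z).im_pos).contDiffAt (isOpen_upperHalfPlaneSet.mem_nhds (p.toSL • z).im_pos))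
  simpa only [mapGL_toSL_smul] using this

/-! ### `Γ₀(q)`-invariance -/

/-- Right multiplication by `γ ∈ Γ₀(q)` permutes the cosets `Γ∞∖Γ₀(q)` (`Γ∞σ_p ↦ Γ∞σ_pγ`, with
inverse `Γ∞σ ↦ Γ∞σγ⁻¹`): `Γ∞ σ_{Γ∞σ_pγ} γ⁻¹ = Γ∞ σ_p`. [folklore] -/
theorem cuspOf_cuspOf_mul_mul_inv (p : CuspPair q) {γ δ : SL(2, ℤ)}
    (hγ : γ ∈ CongruenceSubgroup.Gamma0 q) (hδ : δ ∈ CongruenceSubgroup.Gamma0 q) (hγδ : γ * δ = 1) :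
    RootForms.cuspOf ((RootForms.cuspOf (p.toSL * γ) (Subgroup.mul_mem _ p.toSL_mem hγ)).toSL * δ)
      (Subgroup.mul_mem _ (CuspPair.toSL_mem _) hδ) = p := by
  have hmem : p.toSL * γ ∈ CongruenceSubgroup.Gamma0 q := Subgroup.mul_mem _ p.toSL_mem hγ
  obtain ⟨m, h | h⟩ := RootForms.exists_eq_T_zpow_mul_cuspOf hmem
  · refine RootForms.cuspOf_eq_of_eq _ true (-m) p ?_
    have e : (RootForms.cuspOf (p.toSL * γ) hmem).toSL = T ^ (-m) * (p.toSL * γ) := by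
      conv_rhs => rw [h]
      rw [← mul_assoc, ← zpow_add, neg_add_cancel, zpow_zero, one_mul]
    rw [sgn_true, e, mul_assoc, mul_assoc, hγδ, mul_one]
  · refine RootForms.cuspOf_eq_of_eq _ false (-m) p ?_
    have e : (RootForms.cuspOf (p.toSL * γ) hmem).toSL = -(T ^ (-m) * (p.toSL * γ)) := by
      conv_rhs => rw [h]
      rw [mul_neg, neg_neg, ← mul_assoc, ← zpow_add, neg_add_cancel, zpow_zero, one_mul]
    rw [sgn_false, e, neg_mul, mul_assoc, mul_assoc, hγδ, mul_one]

/-- **`Γ₀(q)`-invariance of the Poincaré series** of a `T`-invariant kernel: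
`P_φ(γ • z) = P_φ(z)` for `γ ∈ Γ₀(q)` (reindex the cosets by `Γ∞σ ↦ Γ∞σγ`).
[cite: Iwaniec2002, §3.2] -/
theorem poincareFn_smul_of_mem_Gamma0 (q : ℕ) {φ : ℍ → ℂ} (hT : ∀ z : ℍ, φ (T • z) = φ z)
    {γ : SL(2, ℤ)} (hγ : γ ∈ CongruenceSubgroup.Gamma0 q) (z : ℍ) :
    RootForms.poincareFn q φ (γ • z) = RootForms.poincareFn q φ z := by
  have hγi : γ⁻¹ ∈ CongruenceSubgroup.Gamma0 q := Subgroup.inv_mem _ hγ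
  -- the permutation of the cosets
  let e : CuspPair q ≃ CuspPair q :=
    { toFun := fun p => RootForms.cuspOf (p.toSL * γ) (Subgroup.mul_mem _ p.toSL_mem hγ)
      invFun := fun p => RootForms.cuspOf (p.toSL * γ⁻¹) (Subgroup.mul_mem _ p.toSL_mem hγi)
      left_inv := fun p => cuspOf_cuspOf_mul_mul_inv p hγ hγi (mul_inv_cancel γ)
      right_inv := fun p => cuspOf_cuspOf_mul_mul_inv p hγi hγ (inv_mul_cancel γ) }
  unfold RootForms.poincareFn
  have he : ∀ p : CuspPair q, φ (p.toSL • γ • z) = φ ((e p).toSL • z) := by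
    intro p
    change φ (p.toSL • γ • z) =
      φ ((RootForms.cuspOf (p.toSL * γ) (Subgroup.mul_mem _ p.toSL_mem hγ)).toSL • z)
    rw [RootForms.apply_cuspOf_smul hT, mul_smul]
  simp_rw [he]
  exact e.tsum_eq (fun p : CuspPair q => φ (p.toSL • z))

/-! ### The uniform bound -/

/-- The box `[0, 1] × [Y₁, Y₂]` in `ℍ` (`Y₁ > 0`) is compact (the preimage of a compact rectangle
of `ℂ` contained in the open half-plane, under the embedding `ℍ → ℂ`). [folklore] -/
theorem isCompact_box {Y₁ Y₂ : ℝ} (hY₁ : 0 < Y₁) :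
    IsCompact {w : ℍ | w.re ∈ Icc (0 : ℝ) 1 ∧ w.im ∈ Icc Y₁ Y₂} := by
  have hK : IsCompact ((Icc (0 : ℝ) 1) ×ℂ (Icc Y₁ Y₂)) := isCompact_Icc.reProdIm isCompact_Icc
  have hsub : (Icc (0 : ℝ) 1) ×ℂ (Icc Y₁ Y₂) ⊆ range ((↑) : ℍ → ℂ) := by
    rintro w ⟨-, hw⟩
    exact ⟨⟨w, lt_of_lt_of_le hY₁ hw.1⟩, rfl⟩
  have himage : {w : ℍ | w.re ∈ Icc (0 : ℝ) 1 ∧ w.im ∈ Icc Y₁ Y₂} =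
      ((↑) : ℍ → ℂ) ⁻¹' ((Icc (0 : ℝ) 1) ×ℂ (Icc Y₁ Y₂)) := by
    ext w
    simp only [mem_setOf_eq, mem_preimage, Complex.mem_reProdIm, UpperHalfPlane.coe_re,
      UpperHalfPlane.coe_im]
  rw [himage]
  exact UpperHalfPlane.isOpenEmbedding_coe.isInducing.isCompact_preimage' hK hsub

/-- The box is measurable. [folklore] -/
theorem measurableSet_box (Y₁ Y₂ : ℝ) :
    MeasurableSet {w : ℍ | w.re ∈ Icc (0 : ℝ) 1 ∧ w.im ∈ Icc Y₁ Y₂} :=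
  (measurableSet_Icc.preimage UpperHalfPlane.continuous_re.measurable).inter
    (measurableSet_Icc.preimage UpperHalfPlane.continuous_im.measurable)

/-- **Counting the cosets at heights `[Y₁, Y₂]`**: if every `SL₂(ℤ)`-orbit meets the box
`[0,1] × [Y₁,Y₂]` in at most `M` points, then at most `M` cosets `σ ∈ Γ∞∖Γ₀(q)` lift a given `z`
into the heights `[Y₁, Y₂]` (the lifts `T^{-⌊Re σ_p z⌋} σ_p`, which land in the box, are pairwise
distinct elements of `SL₂(ℤ)`). [cite: Iwaniec2002, §2.3] -/
theorem card_filter_heights_le {Y₁ Y₂ : ℝ} {M : ℕ}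
    (hM : ∀ w : ℍ, ∑' γ : (𝒮ℒ : Subgroup (GL (Fin 2) ℝ)),
      {w : ℍ | w.re ∈ Icc (0 : ℝ) 1 ∧ w.im ∈ Icc Y₁ Y₂}.indicator (1 : ℍ → ℝ≥0∞) (γ • w) ≤ M)
    (S : Finset (CuspPair q)) (z : ℍ) :
    ((S.filter fun p => Y₁ ≤ (p.toSL • z).im ∧ (p.toSL • z).im ≤ Y₂).card : ℝ≥0∞) ≤ M := by
  classical
  set K : Set ℍ := {w : ℍ | w.re ∈ Icc (0 : ℝ) 1 ∧ w.im ∈ Icc Y₁ Y₂} with hK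
  -- the normalised lifts `T^{-⌊Re σ_p z⌋} σ_p ∈ SL₂(ℤ) ≤ GL₂(ℝ)`
  let ι : CuspPair q → (𝒮ℒ : Subgroup (GL (Fin 2) ℝ)) := fun p =>
    ⟨Matrix.SpecialLinearGroup.mapGL ℝ (T ^ (-⌊(p.toSL • z).re⌋) * p.toSL), ⟨_, rfl⟩⟩
  have hι_smul : ∀ p : CuspPair q, (ι p) • z = T ^ (-⌊(p.toSL • z).re⌋) • p.toSL • z := by
    intro p
    change (T ^ (-⌊(p.toSL • z).re⌋) * p.toSL) • z = _
    rw [mul_smul]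
  have hι_inj : Function.Injective ι := by
    intro p p' h
    have h1 : T ^ (-⌊(p.toSL • z).re⌋) * p.toSL = T ^ (-⌊(p'.toSL • z).re⌋) * p'.toSL :=
      mapGL_injective (congrArg (fun γ : (𝒮ℒ : Subgroup (GL (Fin 2) ℝ)) => (γ : GL (Fin 2) ℝ)) h)
    have h2 : decomp q (true, -⌊(p.toSL • z).re⌋, p) =
        decomp q (true, -⌊(p'.toSL • z).re⌋, p') := by
      simpa [decomp] using h1
    have h3 := decomp_injective h2
    simp only [Prod.mk.injEq] at h3
    exact h3.2.2
  have hι_mem : ∀ p : CuspPair q, Y₁ ≤ (p.toSL • z).im → (p.toSL • z).im ≤ Y₂ → (ι p) • z ∈ K := by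
    intro p h1 h2
    rw [hι_smul]
    refine ⟨?_, ?_⟩
    · rw [ModularGroup.re_T_zpow_smul]
      push_cast
      constructor
      · linarith [Int.floor_le (p.toSL • z).re]
      · linarith [Int.lt_floor_add_one (p.toSL • z).re]
    · rw [ModularGroup.im_T_zpow_smul]
      exact ⟨h1, h2⟩
  set S' := S.filter fun p => Y₁ ≤ (p.toSL • z).im ∧ (p.toSL • z).im ≤ Y₂ with hS'
  calc ((S'.card : ℕ) : ℝ≥0∞) = ∑ p ∈ S', (1 : ℝ≥0∞) := by simp
    _ = ∑ p ∈ S', K.indicator (1 : ℍ → ℝ≥0∞) ((ι p) • z) := by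
        refine Finset.sum_congr rfl fun p hp => ?_
        rw [Finset.mem_filter] at hp
        rw [indicator_of_mem (hι_mem p hp.2.1 hp.2.2)]
        rfl
    _ = ∑ γ ∈ S'.image ι, K.indicator (1 : ℍ → ℝ≥0∞) (γ • z) := by
        rw [Finset.sum_image]
        intro p _ p' _ h
        exact hι_inj h
    _ ≤ ∑' γ : (𝒮ℒ : Subgroup (GL (Fin 2) ℝ)), K.indicator (1 : ℍ → ℝ≥0∞) (γ • z) :=
        ENNReal.sum_le_tsum _
    _ ≤ M := hM z

/-- **The uniform bound for the Poincaré series**: if `|φ| ≤ B`, `φ` is supported in the heights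
`[Y₁, Y₂]` with `Y₁ > 0`, then `|P_φ(z)| ≤ M B` for all `z`, `M` the covering multiplicity of the
box `[0,1] × [Y₁,Y₂]` under `SL₂(ℤ)`. [cite: Iwaniec2002, §3.2] -/
theorem norm_poincareFn_le_of_multiplicity {φ : ℍ → ℂ} {Y₁ Y₂ B : ℝ} (hY₁ : 0 < Y₁) (hB : 0 ≤ B)
    (hφ : ∀ z : ℍ, φ z ≠ 0 → Y₁ ≤ z.im ∧ z.im ≤ Y₂) (hφB : ∀ z : ℍ, ‖φ z‖ ≤ B) {M : ℕ}
    (hM : ∀ w : ℍ, ∑' γ : (𝒮ℒ : Subgroup (GL (Fin 2) ℝ)),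
      {w : ℍ | w.re ∈ Icc (0 : ℝ) 1 ∧ w.im ∈ Icc Y₁ Y₂}.indicator (1 : ℍ → ℝ≥0∞) (γ • w) ≤ M)
    (z : ℍ) :
    ‖RootForms.poincareFn q φ z‖ ≤ M * B := by
  classical
  obtain ⟨S, U, hU, hS⟩ := exists_finset_nhds_of_height q hY₁ z
  have hSz := hS z (mem_of_mem_nhds hU)
  rw [poincareFn_eq_sum_of_height (fun w hw => (hφ w hw).1) hSz]
  set S' := S.filter fun p => Y₁ ≤ (p.toSL • z).im ∧ (p.toSL • z).im ≤ Y₂ with hS'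
  have hsplit : ∑ p ∈ S, φ (p.toSL • z) = ∑ p ∈ S', φ (p.toSL • z) := by
    rw [hS', Finset.sum_filter]
    refine Finset.sum_congr rfl fun p _ => ?_
    by_cases h : φ (p.toSL • z) = 0
    · rw [h]; split_ifs <;> rfl
    · rw [if_pos (hφ _ h)]
  rw [hsplit]
  have hcard : (S'.card : ℝ) ≤ M := by
    have := card_filter_heights_le (q := q) hM S z
    rw [← hS'] at this
    exact_mod_cast this
  calc ‖∑ p ∈ S', φ (p.toSL • z)‖ ≤ ∑ p ∈ S', ‖φ (p.toSL • z)‖ := norm_sum_le _ _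
    _ ≤ ∑ p ∈ S', B := Finset.sum_le_sum fun p _ => hφB _
    _ = S'.card * B := by rw [Finset.sum_const, nsmul_eq_mul]
    _ ≤ M * B := mul_le_mul_of_nonneg_right hcard hB

/-- The covering multiplicity of the box `[0,1] × [Y₁,Y₂]` (`Y₁ > 0`) under `SL₂(ℤ)` is finite
(`exists_multiplicity_bound`). [cite: Iwaniec2002, §2.1] -/
theorem exists_multiplicity_box {Y₁ : ℝ} (Y₂ : ℝ) (hY₁ : 0 < Y₁) :
    ∃ M : ℕ, ∀ w : ℍ, ∑' γ : (𝒮ℒ : Subgroup (GL (Fin 2) ℝ)),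
      {w : ℍ | w.re ∈ Icc (0 : ℝ) 1 ∧ w.im ∈ Icc Y₁ Y₂}.indicator (1 : ℍ → ℝ≥0∞) (γ • w) ≤ M :=
  exists_multiplicity_bound (isCompact_box (Y₂ := Y₂) hY₁)

/-- **The uniform bound, existential form**: a kernel bounded by `B ≥ 0` and supported in the
heights `[Y₁, Y₂]`, `Y₁ > 0`, has a Poincaré series bounded by a constant depending only on
`Y₁, Y₂, B`, uniformly in the level `q` and the point. [cite: Iwaniec2002, §3.2] -/
theorem exists_norm_poincareFn_le {Y₁ : ℝ} (Y₂ : ℝ) (hY₁ : 0 < Y₁) :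
    ∃ C : ℝ, 0 ≤ C ∧ ∀ (q : ℕ) (φ : ℍ → ℂ) (B : ℝ), 0 ≤ B →
      (∀ z : ℍ, φ z ≠ 0 → Y₁ ≤ z.im ∧ z.im ≤ Y₂) → (∀ z : ℍ, ‖φ z‖ ≤ B) →
      ∀ z : ℍ, ‖RootForms.poincareFn q φ z‖ ≤ C * B := by
  obtain ⟨M, hM⟩ := exists_multiplicity_box Y₂ hY₁
  exact ⟨M, Nat.cast_nonneg M, fun q φ B hB hφ hφB z =>
    norm_poincareFn_le_of_multiplicity (q := q) hY₁ hB hφ hφB hM z⟩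

end DFI1995

end Literature.NumberTheory.Sieve
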